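/- Copyright: the b2b-balaban cell (near-miss cell 7), T⁴-continuum CRUX team (coordinator ruling e34b3e0c item (2)), row NE7b,
lineage t4-ne7b-formalise-leaf-02 (gen 126; E-side ∕ key-readings lineage) — J2a «what a key-pattern choice books», in the consumer
form of IR-104-2's row `pwA` (OWNER `t4-ne7b-p1` ruling W-ne7bp1-g104-1 (2): «a lemma ABOUT `keyPattern`, owed where (β)'s analyst
wants it»; W-ne7bp1-g104-4: `pwA` = `PointwiseExtraction` along `keyPattern`).  Released under the licence of the surrounding project. -/
import Summits.QuantumFields.BalabanUV.T4Continuum.Spine.NE7b.LocalConditionalStability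
import Summits.QuantumFields.BalabanUV.T4Continuum.Spine.NE7b.KeyPatternReading

/-!
# WHAT A KEY-PATTERN CHOICE BOOKS (J2a), AND POINTWISE EXTRACTION ALONG THE KEY PATTERN FROM A FIELD-SUPPORT
# READING OF THE STEP KERNEL (row NE7b, node U5c; E-side bookkeeping for IR-104-2's row `pwA`)

Crux-route work under `Spine/NE7b/` of the T⁴-continuum cell (rung (B)+1 on a FINITE torus only; NOT infinite volume, NOT the mass
gap, NOT Clay; NOT a proof of NE7b — `T4WeightBudget.RelWeightBound`, the cell's OWN estimate, NOT PRINTED, NOT PROVED).  [folklore]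
finite combinatorics and one finite-sum inequality over the TREE's own objects: IR-104-1's key pattern (`KeyPatternReading.keyPattern`),
the causal step reading (`B16HistoryReprReadCausal.StepReading`, `runPartial`, `reading`), leaf-05's process and its CAUSALITY
(`HistoryGenealogyInstantiate.RunInputM.StM_congr ∕ histM_comp_congr ∕ histM_constit_congr ∕ rnwM_congr`), the key fibres
(`T4LiveClassFibration.fibre`) and gaps-ne6's two halves of «LCS-j» (`LocalConditionalStability.PointwiseExtraction`,
`chebyshev_extraction`).  It types NO `T4Continuum/Support` leaf, mints no `Prop`, carries no `[cite:]` tag, asserts nothing of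
Bałaban's; zero `sorry`.

WHY.  IR-104-2's record (`B16HistoryTowerExtractionStepDataLWR`, gaps-ne6 g9) DISPLAYS per bad key `k` of the window the row
`pwA : PointwiseExtraction (T K) (keyPattern T p₀ (kmemA …) K k) K (χ K) (MA K k t) (fun j _ => aA K k j)` — at every prefix `g` in
the key pattern's class, the step's characteristic functions of the PINNED choices `p ∈ branch j g ∩ keyPattern … K k j g` sum to at
most `e^{−aA K k j}·MA` pointwise.  Its mechanism is print's «we estimate the factors by exp(−p₀(g_j))» = `chebyshev_extraction`
(PROVED), which wants ONE functional `Q` with `{χ_p ≠ 0} ⊆ {θ ≤ Q}` for ALL pinned `p` at once.  What makes the pinned choices share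
such a `Q` is J2a (OWNER ruling W-ne7bp1-g104-1 (2), IR-104-1's docstring): «`p ∈ keyPattern … j g` ⇒ `p` realises the events `k` books
at level `j + 1`».  THIS FILE proves J2a in the form the mechanism consumes and inhabits `pwA`'s SHAPE from displays of print's kind.

WHAT.  §1 J2a, RUN FORM: a key-pattern choice `p` after `g` at step `j` comes with a fibre history `h` (`kmem K (histIdx h) = k`,
`h|_j = g`, `h j = p`); the run the causal reading assigns to `histIdx h` IS `𝒮.runPartial K K h` (`run_histIdx`, `rfl`); the run read
off a prefix agrees with it on the new regions of the levels `≤ m` and the new fields of the levels `< m` (`N_runPartial_take`,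
`F_runPartial_take`), hence — CAUSALITY — on the process state, components, constituents (levels `≤ m`) and renewal flags (levels
`< m`) (`StM ∕ histM_comp ∕ histM_constit ∕ rnwM_runPartial_take`); packaged: **`exists_fibre_run_of_mem_keyPattern`** — some term
`τ` of the fibre of `k` books at level `j + 1` EXACTLY the regions `𝒮.ν K j g p` the choice names, and its process up to level `j + 1`
IS the process read off `snoc g p` (the currency of IR-104-2's print-side rows `hclass ∕ hcube ∕ hdisp`, which read carriers off
`𝒮.runPartial K (j + 1) (Fin.snoc g p)`).  §2 **`commonN 𝒮 T p₀ kmem K k ℓ`** := the regions booked at level `ℓ` by EVERY term of the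
fibre of `k` — a function of `(K, k, ℓ)` alone; `mem_commonN`, `commonN_subset_N`, `subset_commonN` (it is the LARGEST region family
booked by every fibre term, when the fibre is non-empty); J2a, BOOKED FORM: **`subset_ν_of_forall_fibre`** (a region family booked at
level `j + 1` by every fibre term is named by every key-pattern choice at step `j`), **`commonN_subset_ν`**, and the same READ THROUGH A
VALUE MAP `v : Lab d → V` (**`subset_image_ν_of_forall_fibre`** — for keys recording PLACED births, e.g. the datum of record
`physV`).  §3 **POINTWISE EXTRACTION ALONG THE KEY PATTERN** — `pwA`'s shape INHABITED BY NAME: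
**`pointwiseExtraction_keyPattern_of_support`** — from (d1) `hle1`
(the pinned characteristic functions sum to at most one at every pattern prefix; from positivity + the decomposition of unity `hunit`
by `sum_inter_le_one`, corollary **`pointwiseExtraction_keyPattern_of_unit`**), (d2) the FIELD-SUPPORT READING `hsupp` of the step
kernel (wherever `χ K j g p y ≠ 0`, the functional `F j Z y` of EVERY region `Z ∈ 𝒮.ν K j g p` the choice names is at least its
threshold `θ j Z` — [Balaban1989LargeFieldI] (1.22)–(1.28) pp. 181–183: the large-field characteristic functions restrict the new
field to exceed `p₀(g_j)` on the cubes of the region; print's DEFINITION of its `χ`, (A1c)'s to read — LOCATOR only) and (d3) a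
region family `R (j + 1)` booked at level `j + 1` by every fibre term of `k` (`hR`): `PointwiseExtraction (T K) (keyPattern … K k) K χ M a`
with `a j = δ·Σ_{Z ∈ R (j+1)} θ j Z` and the carrier `M j y = exp (δ·Σ_{Z ∈ R (j+1)} F j Z y)` — the SAME carrier after every prefix,
`δ ≥ 0` free; general value-keyed form **`pointwiseExtraction_keyPattern_of_reading`** (`R (j+1) : Finset V` realised through
`v (j+1)` by every fibre term; `θ`, `F` indexed by values); canonical instance **`pointwiseExtraction_keyPattern_commonN`**
(`R := commonN …`).  So, BY NAME, IR-104-2's `pwA` at an (A1c) instance reduces to (d1) + (d2) — displays of print's kind about the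
instance's OWN step kernel — plus the choice of `R`; and the
carrier its twin row `lcsA : LocCondStability …` must bound is NAMED: the exponential moment of the sacrificed functional
`δ·Σ_{Z ∈ R (j+1)} F j Z` over the key's level-`(j+1)` regions in the history term's own state (gaps-ne6's docstring «`M = e^{δQ_{j,Z}}`»,
`b = O(1)·Σ|Z|` — THE residual of Bałaban's KIND, not here).

NOT HERE (honest).  (A1c)'s step kernel `χ` and its reading (d2); positivity (d1) of Bałaban's characteristic functions (regime (R) of
PRICING-NE7b π-ne7bref-g63-4); the PEDIGREE READING «the key's recorded births at level `ℓ` are booked at level `ℓ` by every term of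
its fibre» (E-side, a lemma about ONE term and its own key: for the key family OF RECORD `kmemA`, whose datum PLACES births, it holds
READ THROUGH THE PLACEMENT and supplies (d3) of `…_of_reading` with `R :=` the key's recorded birth values — the sequel
`KeyBirthsBooked`; it also ties `a` to the ledger row `ledgerA`'s member prices); `lcsA`; run B's twin along
`KeyPatternReadingB.keyPatternB` (the same proofs for any `classPattern` — the sequel `ClassPatternBooking`).  BY-NAME EFFECT ON THE
WALL: NONE — `pwA` becomes a theorem GIVEN (d1)–(d3); nothing of Bałaban's is discharged.  NE7b NOT PRINTED ∕ NOT PROVED; spine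
PROVED 0∕9.  HONEST DEPENDENCY (cell): continuum YM on T⁴ ⇐ BetaPertH ∧ nine spine estimates (0/9 proved); BetaPertH ⇐ (D1) ∧ (D4) ∧
CAP+tail; G-an2-4 gates asym, D1 and NE2/3/4.  This file changes none of it.
-/

set_option autoImplicit false

open Finset Real
open Literature.MathematicalPhysics.QuantumFieldTheory.Balaban1983to89
open Literature.MathematicalPhysics.QuantumFieldTheory.Balaban1983to89.T4LiveClassFibration
open Literature.MathematicalPhysics.QuantumFieldTheory.Balaban1983to89.B13ScaleTransfer
open Summit.QuantumFields.BalabanUV.T4Continuum.HistoryGenealogyRealise (Lab)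
open Summit.QuantumFields.BalabanUV.T4Continuum.HistoryGenealogyInstantiate
open Summit.QuantumFields.BalabanUV.T4Continuum.B16HistoryIndexedRepr
open Summit.QuantumFields.BalabanUV.T4Continuum.B16HistoryReprChain
open Summit.QuantumFields.BalabanUV.T4Continuum.B16HistoryReprInstance
open Summit.QuantumFields.BalabanUV.T4Continuum.B16HistoryReprReadCausal
open Summit.QuantumFields.BalabanUV.T4Continuum.NE7b.PrefixExtraction
open Summit.QuantumFields.BalabanUV.T4Continuum.NE7b.PrefixExtractionLaws
open Summit.QuantumFields.BalabanUV.T4Continuum.NE7b.LocalConditionalStability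
open Summit.QuantumFields.BalabanUV.T4Continuum.NE7b.KeyPatternReading

namespace Summit.QuantumFields.BalabanUV.T4Continuum.NE7b.KeyPatternBooking

noncomputable section

/-! ## §1 J2a, run form: a key-pattern choice is a step of a fibre history; the run read off a prefix is the history's run up to
the prefix (regions, fields, and — causality — the process) -/

section RunForm

variable {P : Type} [DecidableEq P] {d : ℕ} (𝒮 : StepReading P d) {C : ℕ → ℕ → Type} {𝒢 : (K j : ℕ) → GoodClass (C K j)}
  (T : (K : ℕ) → Tower P (C K) (𝒢 K)) (p₀ : ℕ → ℕ → P) {ω : Type*} [DecidableEq ω]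
  (kmem : ℕ → HIndex.Idx (skelFam T p₀) → ω)

/-- **THE RUN OF THE LARGE-SUMMAND TERM OF A HISTORY UNDER THE CAUSAL READING IS THE RUN READ OFF THE HISTORY** (definitionally:
`run_inputOf`, `runOf_reading`). [folklore] -/
theorem run_histIdx (K : ℕ) (h : Fin K → P) :
    (𝒮.reading T p₀).inputOf.run K (histIdx T p₀ K h) = 𝒮.runPartial K K h := rfl

/-- **A KEY-PATTERN CHOICE IS A STEP OF A FIBRE HISTORY**: `p ∈ keyPattern … K k j g` comes with an admissible-length history `h`
whose large-summand term lies in the fibre of `k`, whose prefix of length `j` is `g` and whose step `j` is `p`. [folklore] -/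
theorem exists_fibre_history_of_mem_keyPattern {K : ℕ} {k : ω} {j : ℕ} {g : Fin j → P} {p : P}
    (hp : p ∈ keyPattern T p₀ kmem K k j g) :
    ∃ (h : Fin K → P) (hj : j < K), histIdx T p₀ K h ∈ fibre kmem (HIndex.termSet (skelFam T p₀)) K k ∧
      Fin.take j (Nat.le_of_lt hj) h = g ∧ h ⟨j, hj⟩ = p ∧ Fin.take (j + 1) hj h = Fin.snoc g p := by
  obtain ⟨-, h, hj, hfib, htake⟩ := (mem_keyPattern T p₀ kmem).1 hp
  refine ⟨h, hj, hfib, ?_, ?_, htake⟩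
  · have e := congrArg Fin.init htake
    rw [Fin.take_succ_eq_snoc] at e
    simpa only [Fin.init_snoc] using e
  · have e := congrFun htake (Fin.last j)
    rw [Fin.take_succ_eq_snoc] at e
    simpa only [Fin.snoc_last] using e

omit [DecidableEq P] in
/-- **THE RUN READ OFF A PREFIX OF LENGTH `m` AGREES WITH THE HISTORY's RUN ON THE NEW REGIONS OF THE LEVELS `≤ m`**
(`StepReading.Nof_take_succ`). [folklore] -/
theorem N_runPartial_take (K : ℕ) {m : ℕ} (h : Fin K → P) (hm : m ≤ K) :
    ∀ ℓ, ℓ ≤ m → (𝒮.runPartial K m (Fin.take m hm h)).N ℓ = (𝒮.runPartial K K h).N ℓ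
  | 0, _ => rfl
  | _ + 1, hℓ => 𝒮.Nof_take_succ hm h (Nat.lt_of_succ_le hℓ)

omit [DecidableEq P] in
/-- **… AND ON THE NEW-FIELD CUBES OF THE LEVELS `< m`** (`StepReading.Fof_take`). [folklore] -/
theorem F_runPartial_take (K : ℕ) {m : ℕ} (h : Fin K → P) (hm : m ≤ K) :
    ∀ ℓ, ℓ < m → (𝒮.runPartial K m (Fin.take m hm h)).F ℓ = (𝒮.runPartial K K h).F ℓ :=
  fun _ hℓ => 𝒮.Fof_take hm h hℓ

omit [DecidableEq P] in
/-- **CAUSALITY AT A PREFIX: THE PROCESS STATE OF THE LEVELS `≤ m` IS READ OFF THE PREFIX OF LENGTH `m`** (`RunInputM.StM_congr`).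
[folklore] -/
theorem StM_runPartial_take (K : ℕ) {m : ℕ} (h : Fin K → P) (hm : m ≤ K) {ℓ : ℕ} (hℓ : ℓ ≤ m) :
    (𝒮.runPartial K m (Fin.take m hm h)).StM ℓ = (𝒮.runPartial K K h).StM ℓ :=
  RunInputM.StM_congr (I := 𝒮.runPartial K m (Fin.take m hm h)) (I' := 𝒮.runPartial K K h) rfl rfl rfl ℓ
    (fun m' hm' => N_runPartial_take 𝒮 K h hm m' (hm'.trans hℓ))
    (fun m' hm' => F_runPartial_take 𝒮 K h hm m' (Nat.lt_of_lt_of_le hm' hℓ))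

omit [DecidableEq P] in
/-- … so are the COMPONENTS of the levels `≤ m` (`RunInputM.histM_comp_congr`) … [folklore] -/
theorem histM_comp_runPartial_take (K : ℕ) {m : ℕ} (h : Fin K → P) (hm : m ≤ K) {ℓ : ℕ} (hℓ : ℓ ≤ m) :
    (𝒮.runPartial K m (Fin.take m hm h)).histM.comp ℓ = (𝒮.runPartial K K h).histM.comp ℓ :=
  RunInputM.histM_comp_congr (I := 𝒮.runPartial K m (Fin.take m hm h)) (I' := 𝒮.runPartial K K h) rfl rfl rfl
    (fun m' hm' => N_runPartial_take 𝒮 K h hm m' (hm'.trans hℓ))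
    (fun m' hm' => F_runPartial_take 𝒮 K h hm m' (Nat.lt_of_lt_of_le hm' hℓ))

omit [DecidableEq P] in
/-- … the CONSTITUENT LISTS of the levels `≤ m` (`RunInputM.histM_constit_congr`) … [folklore] -/
theorem histM_constit_runPartial_take (K : ℕ) {m : ℕ} (h : Fin K → P) (hm : m ≤ K) {ℓ : ℕ} (hℓ : ℓ ≤ m) :
    (𝒮.runPartial K m (Fin.take m hm h)).histM.constit ℓ = (𝒮.runPartial K K h).histM.constit ℓ :=
  RunInputM.histM_constit_congr (I := 𝒮.runPartial K m (Fin.take m hm h)) (I' := 𝒮.runPartial K K h) rfl rfl rfl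
    (fun m' hm' => N_runPartial_take 𝒮 K h hm m' (hm'.trans hℓ))
    (fun m' hm' => F_runPartial_take 𝒮 K h hm m' (Nat.lt_of_lt_of_le hm' hℓ))

omit [DecidableEq P] in
/-- … and the RENEWAL FLAGS of the levels `< m` (`RunInputM.rnwM_congr`; level `ℓ`'s flags consult the new fields of level `ℓ`).
[folklore] -/
theorem rnwM_runPartial_take (K : ℕ) {m : ℕ} (h : Fin K → P) (hm : m ≤ K) {ℓ : ℕ} (hℓ : ℓ < m) :
    (𝒮.runPartial K m (Fin.take m hm h)).rnwM ℓ = (𝒮.runPartial K K h).rnwM ℓ :=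
  RunInputM.rnwM_congr (I := 𝒮.runPartial K m (Fin.take m hm h)) (I' := 𝒮.runPartial K K h) rfl rfl rfl
    (fun m' hm' => N_runPartial_take 𝒮 K h hm m' (hm'.trans hℓ.le))
    (fun m' hm' => F_runPartial_take 𝒮 K h hm m' (Nat.lt_of_le_of_lt hm' hℓ))

omit [DecidableEq P] in
/-- **THE REGIONS A HISTORY's STEP `j` NAMES ARE ITS RUN's LEVEL-`(j+1)` BOOKINGS.** [folklore] -/
theorem N_runPartial_succ (K : ℕ) (h : Fin K → P) {j : ℕ} (hj : j < K) :
    (𝒮.runPartial K K h).N (j + 1) = 𝒮.ν K j (Fin.take j (Nat.le_of_lt hj) h) (h ⟨j, hj⟩) := by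
  show 𝒮.Nof K K h (j + 1) = _
  rw [StepReading.Nof, dif_pos hj]

/-- **J2a, RUN FORM.**  If `p` is a key-pattern choice of the key `k` after the prefix `g` at step `j` of run `K`, then SOME TERM `τ` OF
THE FIBRE OF `k` PASSES THROUGH `snoc g p`: under the causal reading its run books at level `j + 1` EXACTLY the regions `𝒮.ν K j g p`
the choice names, agrees with the run read off `snoc g p` on the new regions of the levels `≤ j + 1` and the new fields of the levels
`≤ j`, and — CAUSALITY — has the same process state, components and constituent lists at the levels `≤ j + 1` and the same renewal
flags at the levels `≤ j` as the process read off `snoc g p` («`p` realises at level `j + 1` what a term of key `k` realised there»).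
[folklore] -/
theorem exists_fibre_run_of_mem_keyPattern {K : ℕ} {k : ω} {j : ℕ} {g : Fin j → P} {p : P}
    (hp : p ∈ keyPattern T p₀ kmem K k j g) :
    ∃ τ ∈ fibre kmem (HIndex.termSet (skelFam T p₀)) K k,
      ((𝒮.reading T p₀).inputOf.run K τ).N (j + 1) = 𝒮.ν K j g p ∧
      (∀ ℓ, ℓ ≤ j + 1 → (𝒮.runPartial K (j + 1) (Fin.snoc g p)).N ℓ = ((𝒮.reading T p₀).inputOf.run K τ).N ℓ) ∧
      (∀ ℓ, ℓ ≤ j → (𝒮.runPartial K (j + 1) (Fin.snoc g p)).F ℓ = ((𝒮.reading T p₀).inputOf.run K τ).F ℓ) ∧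
      (∀ ℓ, ℓ ≤ j + 1 → (𝒮.runPartial K (j + 1) (Fin.snoc g p)).StM ℓ = ((𝒮.reading T p₀).inputOf.run K τ).StM ℓ) ∧
      (∀ ℓ, ℓ ≤ j + 1 →
        (𝒮.runPartial K (j + 1) (Fin.snoc g p)).histM.comp ℓ = ((𝒮.reading T p₀).inputOf.run K τ).histM.comp ℓ) ∧
      (∀ ℓ, ℓ ≤ j + 1 →
        (𝒮.runPartial K (j + 1) (Fin.snoc g p)).histM.constit ℓ = ((𝒮.reading T p₀).inputOf.run K τ).histM.constit ℓ) ∧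
      (∀ ℓ, ℓ ≤ j → (𝒮.runPartial K (j + 1) (Fin.snoc g p)).rnwM ℓ = ((𝒮.reading T p₀).inputOf.run K τ).rnwM ℓ) := by
  obtain ⟨h, hj, hfib, hg, hpj, htake⟩ := exists_fibre_history_of_mem_keyPattern T p₀ kmem hp
  refine ⟨histIdx T p₀ K h, hfib, ?_, ?_, ?_, ?_, ?_, ?_, ?_⟩
  · rw [run_histIdx, N_runPartial_succ 𝒮 K h hj, hg, hpj]
  · intro ℓ hℓ
    rw [run_histIdx, ← htake]
    exact N_runPartial_take 𝒮 K h hj ℓ hℓ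
  · intro ℓ hℓ
    rw [run_histIdx, ← htake]
    exact F_runPartial_take 𝒮 K h hj ℓ (Nat.lt_succ_of_le hℓ)
  · intro ℓ hℓ
    rw [run_histIdx, ← htake]
    exact StM_runPartial_take 𝒮 K h hj hℓ
  · intro ℓ hℓ
    rw [run_histIdx, ← htake]
    exact histM_comp_runPartial_take 𝒮 K h hj hℓ
  · intro ℓ hℓ
    rw [run_histIdx, ← htake]
    exact histM_constit_runPartial_take 𝒮 K h hj hℓ
  · intro ℓ hℓ
    rw [run_histIdx, ← htake]
    exact rnwM_runPartial_take 𝒮 K h hj (Nat.lt_succ_of_le hℓ)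

end RunForm

/-! ## §2 The common bookings of a key at a level; J2a, booked form -/

section Booked

variable {P : Type} [DecidableEq P] {d : ℕ} (𝒮 : StepReading P d) {C : ℕ → ℕ → Type} {𝒢 : (K j : ℕ) → GoodClass (C K j)}
  (T : (K : ℕ) → Tower P (C K) (𝒢 K)) (p₀ : ℕ → ℕ → P) {ω : Type*} [DecidableEq ω]
  (kmem : ℕ → HIndex.Idx (skelFam T p₀) → ω)

open scoped Classical in
/-- **THE COMMON BOOKINGS OF THE KEY `k` AT LEVEL `ℓ` OF RUN `K`**: the regions booked at level `ℓ` (under the causal reading) by EVERY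
term of the fibre of `k` at cutoff `K` — a function of `(K, k, ℓ)` alone, empty when the fibre is.  Data, nothing asserted. [folklore] -/
def commonN (K : ℕ) (k : ω) (ℓ : ℕ) : Finset (Lab d) :=
  ((fibre kmem (HIndex.termSet (skelFam T p₀)) K k).biUnion fun τ => ((𝒮.reading T p₀).inputOf.run K τ).N ℓ).filter
    fun Z => ∀ τ ∈ fibre kmem (HIndex.termSet (skelFam T p₀)) K k, Z ∈ ((𝒮.reading T p₀).inputOf.run K τ).N ℓ

/-- membership in the common bookings: the fibre is non-empty and every fibre term books the region at that level. [folklore] -/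
theorem mem_commonN {K : ℕ} {k : ω} {ℓ : ℕ} {Z : Lab d} :
    Z ∈ commonN 𝒮 T p₀ kmem K k ℓ ↔ (fibre kmem (HIndex.termSet (skelFam T p₀)) K k).Nonempty ∧
      ∀ τ ∈ fibre kmem (HIndex.termSet (skelFam T p₀)) K k, Z ∈ ((𝒮.reading T p₀).inputOf.run K τ).N ℓ := by
  classical
  simp only [commonN, Finset.mem_filter, Finset.mem_biUnion]
  constructor
  · rintro ⟨⟨τ, hτ, -⟩, hall⟩
    exact ⟨⟨τ, hτ⟩, hall⟩
  · rintro ⟨⟨τ, hτ⟩, hall⟩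
    exact ⟨⟨τ, hτ, hall τ hτ⟩, hall⟩

/-- the common bookings are bookings of every fibre term. [folklore] -/
theorem commonN_subset_N {K : ℕ} {k : ω} (ℓ : ℕ) {τ : HIndex.Idx (skelFam T p₀)}
    (hτ : τ ∈ fibre kmem (HIndex.termSet (skelFam T p₀)) K k) :
    commonN 𝒮 T p₀ kmem K k ℓ ⊆ ((𝒮.reading T p₀).inputOf.run K τ).N ℓ :=
  fun _ hZ => ((mem_commonN 𝒮 T p₀ kmem).1 hZ).2 τ hτ

/-- **MAXIMALITY**: over a non-empty fibre, a region family booked at level `ℓ` by every fibre term lies in the common bookings.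
[folklore] -/
theorem subset_commonN {K : ℕ} {k : ω} {ℓ : ℕ} {R : Finset (Lab d)}
    (hne : (fibre kmem (HIndex.termSet (skelFam T p₀)) K k).Nonempty)
    (hR : ∀ τ ∈ fibre kmem (HIndex.termSet (skelFam T p₀)) K k, R ⊆ ((𝒮.reading T p₀).inputOf.run K τ).N ℓ) :
    R ⊆ commonN 𝒮 T p₀ kmem K k ℓ :=
  fun _ hZ => (mem_commonN 𝒮 T p₀ kmem).2 ⟨hne, fun τ hτ => hR τ hτ hZ⟩

/-- **J2a, BOOKED FORM: A REGION FAMILY BOOKED AT LEVEL `j + 1` BY EVERY TERM OF THE FIBRE OF `k` IS NAMED BY EVERY KEY-PATTERN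
CHOICE OF `k` AT STEP `j`** (after any prefix). [folklore] -/
theorem subset_ν_of_forall_fibre {K : ℕ} {k : ω} {j : ℕ} {g : Fin j → P} {p : P}
    (hp : p ∈ keyPattern T p₀ kmem K k j g) {R : Finset (Lab d)}
    (hR : ∀ τ ∈ fibre kmem (HIndex.termSet (skelFam T p₀)) K k, R ⊆ ((𝒮.reading T p₀).inputOf.run K τ).N (j + 1)) :
    R ⊆ 𝒮.ν K j g p := by
  obtain ⟨τ, hτ, hN, -⟩ := exists_fibre_run_of_mem_keyPattern 𝒮 T p₀ kmem hp
  rw [← hN]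
  exact hR τ hτ

/-- **… IN PARTICULAR THE COMMON BOOKINGS OF `k` AT LEVEL `j + 1` ARE NAMED BY EVERY KEY-PATTERN CHOICE OF `k` AT STEP `j`.**
[folklore] -/
theorem commonN_subset_ν {K : ℕ} {k : ω} {j : ℕ} {g : Fin j → P} {p : P} (hp : p ∈ keyPattern T p₀ kmem K k j g) :
    commonN 𝒮 T p₀ kmem K k (j + 1) ⊆ 𝒮.ν K j g p :=
  subset_ν_of_forall_fibre 𝒮 T p₀ kmem hp fun _ hτ => commonN_subset_N 𝒮 T p₀ kmem (j + 1) hτ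

/-- **J2a, BOOKED FORM, READ THROUGH A VALUE MAP** (for keys that record their births by a READING `v` of the regions — e.g. the
physical datum of record `HistoryJoinsPlacedMult.physV`, which places a birth region as (corner cell, template) and so determines it
only up to that reading): a family of VALUES realised at level `j + 1` by every term of the fibre of `k` is realised by the regions
every key-pattern choice of `k` names at step `j`. [folklore] -/
theorem subset_image_ν_of_forall_fibre {V : Type*} [DecidableEq V] (v : Lab d → V) {K : ℕ} {k : ω} {j : ℕ} {g : Fin j → P}
    {p : P} (hp : p ∈ keyPattern T p₀ kmem K k j g) {R : Finset V}
    (hR : ∀ τ ∈ fibre kmem (HIndex.termSet (skelFam T p₀)) K k, R ⊆ (((𝒮.reading T p₀).inputOf.run K τ).N (j + 1)).image v) :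
    R ⊆ (𝒮.ν K j g p).image v := by
  obtain ⟨τ, hτ, hN, -⟩ := exists_fibre_run_of_mem_keyPattern 𝒮 T p₀ kmem hp
  rw [← hN]
  exact hR τ hτ

end Booked

/-! ## §3 Pointwise extraction along the key pattern from a field-support reading of the step kernel -/

section Extraction

variable {P : Type} [DecidableEq P] {d : ℕ} (𝒮 : StepReading P d) {C : ℕ → ℕ → Type} {𝒢 : (K j : ℕ) → GoodClass (C K j)}
  (T : (K : ℕ) → Tower P (C K) (𝒢 K)) (p₀ : ℕ → ℕ → P) {ω : Type*} [DecidableEq ω]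
  (kmem : ℕ → HIndex.Idx (skelFam T p₀) → ω)

/-- Non-negative weights summing to one over a finite set sum to at most one over any part of it (the positivity route to (d1);
cf. `LocalConditionalStability.unpinned_extraction`). [folklore] -/
theorem sum_inter_le_one {ι Y : Type*} [DecidableEq ι] (s S : Finset ι) (χ : ι → Y → ℝ) (y : Y)
    (h0 : ∀ p ∈ s, 0 ≤ χ p y) (h1 : ∑ p ∈ s, χ p y = 1) : ∑ p ∈ s ∩ S, χ p y ≤ 1 := by
  rw [← h1]
  exact Finset.sum_le_sum_of_subset_of_nonneg Finset.inter_subset_left fun p hp _ => h0 p hp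

/-- **POINTWISE EXTRACTION ALONG THE KEY PATTERN, THE EXTRACTED SET READ THROUGH A VALUE MAP** (the general form: regions enter
the threshold ∕ functional only through a reading `v (j+1) : Lab d → V`, and (d3) asks the VALUE family `R (j + 1)` to be realised at level
`j + 1` by every fibre term — the form a key recording PLACED births supplies; `v := id` is `pointwiseExtraction_keyPattern_of_support`).
From (d1) `hle1`, (d2) `hsupp` read through `v`, (d3) `hR`: `PointwiseExtraction` along the key pattern with
`a j = δ·Σ_{w ∈ R (j+1)} θ j w` and carrier `M j y = exp (δ·Σ_{w ∈ R (j+1)} F j w y)` — `chebyshev_extraction` at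
`Q := Σ_{w ∈ R (j+1)} F j w`. [folklore] -/
theorem pointwiseExtraction_keyPattern_of_reading {V : Type*} [DecidableEq V] (v : ℕ → Lab d → V) (K : ℕ) (k : ω)
    (χ : (j : ℕ) → (Fin j → P) → P → C K j → ℝ) (F : (j : ℕ) → V → C K j → ℝ) (θ : ℕ → V → ℝ) {δ : ℝ}
    (hδ : 0 ≤ δ) (R : ℕ → Finset V)
    (hR : ∀ j, j < K → ∀ τ ∈ fibre kmem (HIndex.termSet (skelFam T p₀)) K k,
      R (j + 1) ⊆ (((𝒮.reading T p₀).inputOf.run K τ).N (j + 1)).image (v (j + 1)))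
    (hle1 : ∀ j g, j < K → g ∈ admS (T K) (keyPattern T p₀ kmem K k) j → ∀ y,
      ∑ p ∈ (T K).branch j g ∩ keyPattern T p₀ kmem K k j g, χ j g p y ≤ 1)
    (hsupp : ∀ j g p, j < K → g ∈ (T K).adm j → p ∈ (T K).branch j g → ∀ y, χ j g p y ≠ 0 →
      ∀ Z ∈ 𝒮.ν K j g p, θ j (v (j + 1) Z) ≤ F j (v (j + 1) Z) y) :
    PointwiseExtraction (T K) (keyPattern T p₀ kmem K k) K χ (fun j _ y => exp (δ * ∑ w ∈ R (j + 1), F j w y))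
      fun j _ => δ * ∑ w ∈ R (j + 1), θ j w := by
  intro j g hj hg y
  refine chebyshev_extraction ((T K).branch j g ∩ keyPattern T p₀ kmem K k j g) (fun p => χ j g p)
    (fun y => ∑ w ∈ R (j + 1), F j w y) hδ (hle1 j g hj hg) (fun p hp y' hne => ?_) y
  obtain ⟨hb, hk⟩ := Finset.mem_inter.1 hp
  have hsub : R (j + 1) ⊆ (𝒮.ν K j g p).image (v (j + 1)) :=
    subset_image_ν_of_forall_fibre 𝒮 T p₀ kmem (v (j + 1)) hk (hR j hj)
  refine Finset.sum_le_sum fun w hw => ?_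
  obtain ⟨Z, hZ, rfl⟩ := Finset.mem_image.1 (hsub hw)
  exact hsupp j g p hj (admS_subset_adm (T K) _ j hg) hb y' hne Z hZ

/-- **POINTWISE EXTRACTION ALONG THE KEY PATTERN FROM A FIELD-SUPPORT READING OF THE STEP KERNEL** (IR-104-2's row `pwA`, its SHAPE
inhabited by name).  At cutoff `K`, for the key `k`, with the step kernel `χ` of the cutoff-`K` tower: suppose
(d1) `hle1` — at every prefix `g` in the key pattern's class the characteristic functions of the PINNED choices sum to at most one;
(d2) `hsupp` — THE FIELD-SUPPORT READING: wherever the characteristic function of the admissible choice `p` after `g` is non-zero,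
the functional `F j Z` of EVERY region `Z ∈ 𝒮.ν K j g p` the choice names is at least its threshold `θ j Z`
([Balaban1989LargeFieldI] (1.22)–(1.28) pp. 181–183, print's DEFINITION of the large-field characteristic functions — LOCATOR;
(A1c)'s to read for its own kernel); (d3) `hR` — the region family `R (j + 1)` is booked at level `j + 1` by every term of the fibre
of `k`.  Then `PointwiseExtraction (T K) (keyPattern … K k) K χ M a` holds with the extracted exponent `a j = δ·Σ_{Z ∈ R (j+1)} θ j Z`
and the moment carrier `M j y = exp (δ·Σ_{Z ∈ R (j+1)} F j Z y)`, the same after every prefix, for every `δ ≥ 0` —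
`chebyshev_extraction` at the ONE functional `Q := Σ_{Z ∈ R (j+1)} F j Z` the pinned choices share by J2a (`subset_ν_of_forall_fibre`).
[folklore] -/
theorem pointwiseExtraction_keyPattern_of_support (K : ℕ) (k : ω) (χ : (j : ℕ) → (Fin j → P) → P → C K j → ℝ)
    (F : (j : ℕ) → Lab d → C K j → ℝ) (θ : ℕ → Lab d → ℝ) {δ : ℝ} (hδ : 0 ≤ δ) (R : ℕ → Finset (Lab d))
    (hR : ∀ j, j < K → ∀ τ ∈ fibre kmem (HIndex.termSet (skelFam T p₀)) K k,
      R (j + 1) ⊆ ((𝒮.reading T p₀).inputOf.run K τ).N (j + 1))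
    (hle1 : ∀ j g, j < K → g ∈ admS (T K) (keyPattern T p₀ kmem K k) j → ∀ y,
      ∑ p ∈ (T K).branch j g ∩ keyPattern T p₀ kmem K k j g, χ j g p y ≤ 1)
    (hsupp : ∀ j g p, j < K → g ∈ (T K).adm j → p ∈ (T K).branch j g → ∀ y, χ j g p y ≠ 0 →
      ∀ Z ∈ 𝒮.ν K j g p, θ j Z ≤ F j Z y) :
    PointwiseExtraction (T K) (keyPattern T p₀ kmem K k) K χ (fun j _ y => exp (δ * ∑ Z ∈ R (j + 1), F j Z y))
      fun j _ => δ * ∑ Z ∈ R (j + 1), θ j Z := by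
  intro j g hj hg y
  refine chebyshev_extraction ((T K).branch j g ∩ keyPattern T p₀ kmem K k j g) (fun p => χ j g p)
    (fun y => ∑ Z ∈ R (j + 1), F j Z y) hδ (hle1 j g hj hg) (fun p hp y' hne => ?_) y
  obtain ⟨hb, hk⟩ := Finset.mem_inter.1 hp
  have hsub : R (j + 1) ⊆ 𝒮.ν K j g p := subset_ν_of_forall_fibre 𝒮 T p₀ kmem hk (hR j hj)
  exact Finset.sum_le_sum fun Z hZ => hsupp j g p hj (admS_subset_adm (T K) _ j hg) hb y' hne Z (hsub hZ)

/-- **… FROM POSITIVITY AND THE DECOMPOSITION OF UNITY** (regime (R): (d1) from `hχ0` + IR-102-1's `hunit` by `sum_inter_le_one`).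
[folklore] -/
theorem pointwiseExtraction_keyPattern_of_unit (K : ℕ) (k : ω) (χ : (j : ℕ) → (Fin j → P) → P → C K j → ℝ)
    (F : (j : ℕ) → Lab d → C K j → ℝ) (θ : ℕ → Lab d → ℝ) {δ : ℝ} (hδ : 0 ≤ δ) (R : ℕ → Finset (Lab d))
    (hR : ∀ j, j < K → ∀ τ ∈ fibre kmem (HIndex.termSet (skelFam T p₀)) K k,
      R (j + 1) ⊆ ((𝒮.reading T p₀).inputOf.run K τ).N (j + 1))
    (hχ0 : ∀ j g p, j < K → g ∈ (T K).adm j → p ∈ (T K).branch j g → ∀ y, 0 ≤ χ j g p y)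
    (hunit : ∀ j g, j < K → g ∈ (T K).adm j → ∀ y, ∑ p ∈ (T K).branch j g, χ j g p y = 1)
    (hsupp : ∀ j g p, j < K → g ∈ (T K).adm j → p ∈ (T K).branch j g → ∀ y, χ j g p y ≠ 0 →
      ∀ Z ∈ 𝒮.ν K j g p, θ j Z ≤ F j Z y) :
    PointwiseExtraction (T K) (keyPattern T p₀ kmem K k) K χ (fun j _ y => exp (δ * ∑ Z ∈ R (j + 1), F j Z y))
      fun j _ => δ * ∑ Z ∈ R (j + 1), θ j Z :=
  pointwiseExtraction_keyPattern_of_support 𝒮 T p₀ kmem K k χ F θ hδ R hR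
    (fun j g hj hg y => sum_inter_le_one _ _ (fun p => χ j g p) y
      (fun p hp => hχ0 j g p hj (admS_subset_adm (T K) _ j hg) hp y) (hunit j g hj (admS_subset_adm (T K) _ j hg) y))
    hsupp

/-- **THE CANONICAL INSTANCE: EXTRACTION OVER THE COMMON BOOKINGS OF THE KEY** (`R := commonN …`, (d3) by `commonN_subset_N`).
[folklore] -/
theorem pointwiseExtraction_keyPattern_commonN (K : ℕ) (k : ω) (χ : (j : ℕ) → (Fin j → P) → P → C K j → ℝ)
    (F : (j : ℕ) → Lab d → C K j → ℝ) (θ : ℕ → Lab d → ℝ) {δ : ℝ} (hδ : 0 ≤ δ)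
    (hle1 : ∀ j g, j < K → g ∈ admS (T K) (keyPattern T p₀ kmem K k) j → ∀ y,
      ∑ p ∈ (T K).branch j g ∩ keyPattern T p₀ kmem K k j g, χ j g p y ≤ 1)
    (hsupp : ∀ j g p, j < K → g ∈ (T K).adm j → p ∈ (T K).branch j g → ∀ y, χ j g p y ≠ 0 →
      ∀ Z ∈ 𝒮.ν K j g p, θ j Z ≤ F j Z y) :
    PointwiseExtraction (T K) (keyPattern T p₀ kmem K k) K χ
      (fun j _ y => exp (δ * ∑ Z ∈ commonN 𝒮 T p₀ kmem K k (j + 1), F j Z y))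
      fun j _ => δ * ∑ Z ∈ commonN 𝒮 T p₀ kmem K k (j + 1), θ j Z :=
  pointwiseExtraction_keyPattern_of_support 𝒮 T p₀ kmem K k χ F θ hδ (commonN 𝒮 T p₀ kmem K k)
    (fun j _ _ hτ => commonN_subset_N 𝒮 T p₀ kmem (j + 1) hτ) hle1 hsupp

end Extraction

end

end Summit.QuantumFields.BalabanUV.T4Continuum.NE7b.KeyPatternBooking
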